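import Mathlib.Analysis.InnerProductSpace.Basic
import HarnessLib

/-!
# Route `UnitScaleTilt`, crux K1 «MinimiserStabilityRegPr» (stmt-QuantumFields-19200) — ARCHITECTURE (A′) ON Σ, F4″-Q: THE (QSMALL) ROW OF THE Σ-ROWS DOOR ✓`hcoS_of_sigmaRowsS` FROM
# {the Σ-identity `Q_c X̃ ↔ −C(W, iX)` (✓`QTw_eq_neg_CmapTw_of_sigma`), a sup row on the chart remainder, the P-A2 binder `Σ_c‖C c‖ ≤ C₁ℓ⁻¹M + C₂ℓ(K + dv)`, P-A4’s `dv ≤ ζK + δ₁ℓ⁻²M`} —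
# the member-independent arithmetic: `Σ_c‖C c‖² ≤ σ·Σ_c‖C c‖`, hence `aQ·w·Σ_c‖C c‖² ≤ qK·K + qM·ℓ⁻²·M` with FOURTH-ORDER constants `qK = aQwσ·C₂(1+ζ)ℓ`, `qM = aQwσ·(C₁ + C₂δ₁)ℓ`

Cell `ym3-torus` ∕ fleet seat `ym-ust-19200-p1` (gen 17, route-R E′ lead ∕ namer).  THEOREMS ONLY (0 `def`, 0 `sorry`); `--supports stmt-QuantumFields-19200`, count-neutral.
YM₃ on T³ is a ladder rung (R3), not the Clay problem; nothing here claims the stub, the crux, `hcoS`, d = 4 or the mass gap.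

WHY (namer WORDS 19 (d), 22; E2E-SIGMA-SPEC row QSMALL).  On Σ the comb twisted average of the representative is minus its chart remainder, so the averaging penalty of print’s `Δ_a`
is `aQ‖Q_c X̃‖² = aQ·w·Σ_c‖C(W, iX) c‖²` (`w` the weight of the Hilbert-letter averaging `Qkc = η•(toL2B ∘ QTw ∘ toL2⁻¹)`: `w = η²·cB`); each `‖C c‖ ≤ σ = O((ℓs)²)` ([Balaban1985Averaging]
Prop. 5 (157) class sup row) and their `ℓ¹` sum is the P-A2 binder.  Print never needs this row (`QA′ = 0` in the chart coordinates (47)); the tree pays `σ = O(ε₂²)` instead, K-uniformly.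

WHAT IS PROVED (ns `…Theorems.Prop7SigmaRowsQSmall`): `sum_norm_sq_le_of_sup_of_sum` (`Σ‖f c‖² ≤ σ·Σ‖f c‖`), `qsmall_arith` (the real-number knit), ★★ `qsmall_of_sigma_rows` (the (QSMALL)
conjunct of ✓`hcoS_of_sigmaRowsS` for an abstract penalty `P = aQ·w·Σ_c‖f c‖²`: `P ≤ (aQwσ·C₂(1+ζ)ℓ)·K + (aQwσ·(C₁ + C₂δ₁)ℓ)·ℓ⁻²·M`).
HONEST SCOPE.  Real arithmetic; member-independent; the identification `‖Qkc W X̃‖² = η²cB·Σ_c‖QTw W X c‖²` and the sup row are consumed by name in the E2E file, not here.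

References: T. Bałaban, CMP 102 (1985) 277–309 [Balaban1985Variational] ((44)–(47) p.285, (106)–(111) p.294); CMP 98 (1985) 17–51 [Balaban1985Averaging] (Prop. 5 (157) p.41);
CMP 99 (1985) 389–434 [Balaban1985BackgroundPropagators] ((3.26) p.395, (3.120) p.420).
-/

set_option autoImplicit false
noncomputable section

open scoped BigOperators

namespace Summit.QuantumFields.YangMills.Theorems.Prop7SigmaRowsQSmall

/-- `Σ_c‖f c‖² ≤ σ·Σ_c‖f c‖` when every `‖f c‖ ≤ σ`. [bookkeeping; cite: Balaban1985Averaging, Prop. 5 (157) p.41] -/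
theorem sum_norm_sq_le_of_sup_of_sum {ι E : Type*} [Fintype ι] [SeminormedAddCommGroup E] (f : ι → E) {σ : ℝ} (hσ : ∀ c, ‖f c‖ ≤ σ) :
    ∑ c, ‖f c‖ ^ 2 ≤ σ * ∑ c, ‖f c‖ := by
  rw [Finset.mul_sum]
  refine Finset.sum_le_sum fun c _ => ?_
  rw [sq]
  exact mul_le_mul_of_nonneg_right (hσ c) (norm_nonneg _)

/-- The knit arithmetic of the (QSMALL) row: `A·S ≤ qK·K + qM·ℓ⁻²·M` from `S ≤ σ·J`, `J ≤ C₁ℓ⁻¹M + C₂ℓ(K + dv)`, `dv ≤ ζK + δ₁ℓ⁻²M` (`A, σ, C₂ ≥ 0`, `ℓ > 0`), with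
`qK := Aσ·C₂(1+ζ)·ℓ`, `qM := Aσ·(C₁ + C₂δ₁)·ℓ`. [bookkeeping; cite: Balaban1985Variational, (106)-(111) p.294] -/
theorem qsmall_arith {A S σ J ℓ M Kc dv C₁ C₂ ζ δ₁ : ℝ} (hA : 0 ≤ A) (hσ : 0 ≤ σ) (hℓ : 0 < ℓ) (hC₂ : 0 ≤ C₂)
    (hS : S ≤ σ * J) (hJ : J ≤ C₁ * ℓ⁻¹ * M + C₂ * ℓ * (Kc + dv)) (hdv : dv ≤ ζ * Kc + δ₁ * (ℓ ^ 2)⁻¹ * M) :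
    A * S ≤ (A * σ * (C₂ * (1 + ζ)) * ℓ) * Kc + (A * σ * (C₁ + C₂ * δ₁) * ℓ) * (ℓ ^ 2)⁻¹ * M := by
  have hne : ℓ ≠ 0 := hℓ.ne'
  -- `J ≤ (C₁ + C₂δ₁)ℓ⁻¹M + C₂(1+ζ)ℓK`
  have hJ' : J ≤ (C₁ + C₂ * δ₁) * ℓ⁻¹ * M + C₂ * (1 + ζ) * ℓ * Kc := by
    have h := mul_le_mul_of_nonneg_left hdv (mul_nonneg hC₂ hℓ.le)
    have e1 : C₂ * ℓ * (ζ * Kc + δ₁ * (ℓ ^ 2)⁻¹ * M) = C₂ * ζ * ℓ * Kc + C₂ * δ₁ * ℓ⁻¹ * M := by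
      field_simp
    rw [e1] at h
    have e2 : C₁ * ℓ⁻¹ * M + C₂ * ℓ * (Kc + dv) = C₁ * ℓ⁻¹ * M + C₂ * ℓ * Kc + C₂ * ℓ * dv := by ring
    have e3 : (C₁ + C₂ * δ₁) * ℓ⁻¹ * M + C₂ * (1 + ζ) * ℓ * Kc = C₁ * ℓ⁻¹ * M + C₂ * ℓ * Kc + (C₂ * ζ * ℓ * Kc + C₂ * δ₁ * ℓ⁻¹ * M) := by ring
    linarith
  have hAσ : 0 ≤ A * σ := mul_nonneg hA hσ
  have h1 : A * S ≤ A * σ * J := by rw [mul_assoc]; exact mul_le_mul_of_nonneg_left hS hA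
  have h2 : A * σ * J ≤ A * σ * ((C₁ + C₂ * δ₁) * ℓ⁻¹ * M + C₂ * (1 + ζ) * ℓ * Kc) := mul_le_mul_of_nonneg_left hJ' hAσ
  have e4 : A * σ * ((C₁ + C₂ * δ₁) * ℓ⁻¹ * M + C₂ * (1 + ζ) * ℓ * Kc)
      = (A * σ * (C₂ * (1 + ζ)) * ℓ) * Kc + (A * σ * (C₁ + C₂ * δ₁) * ℓ) * (ℓ ^ 2)⁻¹ * M := by
    field_simp
    ring
  linarith [h1, h2, e4.le, e4.ge]

/-- ★★ **THE (QSMALL) ROW OF THE Σ-ROWS DOOR FROM THE Σ-IDENTITY, THE SUP ROW, THE P-A2 BINDER AND P-A4** (member-independent form): for an abstract penalty `P = A·Σ_c‖f c‖²`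
(`A = aQ·w ≥ 0`; `f c = C(W, iX) c` by ✓`QTw_eq_neg_CmapTw_of_sigma`), the sup row `‖f c‖ ≤ σ`, the binder `Σ_c‖f c‖ ≤ C₁ℓ⁻¹M + C₂ℓ(K + dv)` and `dv ≤ ζK + δ₁ℓ⁻²M`:
`P ≤ qK·K + qM·ℓ⁻²·M` with `qK = Aσ·C₂(1+ζ)·ℓ`, `qM = Aσ·(C₁ + C₂δ₁)·ℓ` — fourth order (`σ = O((ℓs)²)`), as the door's `κ`-arithmetic wants.
[cite: Balaban1985Variational, (44)-(47) p.285, (106)-(111) p.294; Balaban1985Averaging, Prop. 5 (157) p.41; Balaban1985BackgroundPropagators, (3.120) p.420] -/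
theorem qsmall_of_sigma_rows {ι E : Type*} [Fintype ι] [SeminormedAddCommGroup E] (f : ι → E)
    {P A σ ℓ M Kc dv C₁ C₂ ζ δ₁ : ℝ} (hP : P = A * ∑ c, ‖f c‖ ^ 2) (hA : 0 ≤ A) (hσ : 0 ≤ σ) (hℓ : 0 < ℓ) (hC₂ : 0 ≤ C₂)
    (hsup : ∀ c, ‖f c‖ ≤ σ) (hJ : ∑ c, ‖f c‖ ≤ C₁ * ℓ⁻¹ * M + C₂ * ℓ * (Kc + dv)) (hdv : dv ≤ ζ * Kc + δ₁ * (ℓ ^ 2)⁻¹ * M) :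
    P ≤ (A * σ * (C₂ * (1 + ζ)) * ℓ) * Kc + (A * σ * (C₁ + C₂ * δ₁) * ℓ) * (ℓ ^ 2)⁻¹ * M := by
  rw [hP]
  exact qsmall_arith hA hσ hℓ hC₂ (sum_norm_sq_le_of_sup_of_sum f hsup) hJ hdv

end Summit.QuantumFields.YangMills.Theorems.Prop7SigmaRowsQSmall

end
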